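import Summits.AtomisticToContinuum.Crystallization.Theses.PerronTransitivity
import Summits.AtomisticToContinuum.Crystallization.Theorems.PerronTransitivityTransitiveLocalLimitStubConcentration
import Summits.AtomisticToContinuum.Crystallization.Theorems.PerronTransitivityTransitiveLocalLimitStubCentredLocalLimit
import Summits.AtomisticToContinuum.Crystallization.Theorems.PerronTransitivityTransitiveLocalLimitStubSiteEnergyContinuity

/-!
# Crux `TransitiveLocalLimit` (stmt-AtomisticToContinuum-15100) — birth skeleton `Lines/birth.lean`

Route `PerronTransitivity` (route-AtomisticToContinuum-PerronTransitivity), crux rank 4: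

  `TransitiveLocalLimit` — every sequence of Lennard-Jones ground states `x N` in `ℝ³` has, along a
  subsequence `σ` and after translations `τ j`, a NON-EMPTY uniformly discrete local limit `X` (two-way
  `ε`-matching on every ball `‖·‖ ≤ R`, eventually in `j`) EVERY site of which has site energy
  `Σ'_{q ∈ X, q ≠ p} V_LJ(|p − q|) = 2E*`, `E* = ⨅_Q e_LJ(Q)` (exact energy-transitivity).

THE LINE (finite-`N` concentration ⟹ centred extraction ⟹ continuity), four registered stubs:

* `stub_superBoundSparse` (L, HARDEST, the heart) — in LJ ground states the `θ`-SUPER-bound sites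
  (`𝓔ⁱ ≤ 2E* − θ`) have density `→ 0` (what K* = `NoFractionalGain` gives with weights `1 + t·1_S`;
  attackable directly).
* `stub_concentration_of_superBoundSparse` (M, provable now) — the pinned average `Σ_i 𝓔ⁱ = 2E(N) =
  2E*·N + o(N)` (PROVED `crysEnergyLimit`) turns one-sided sparsity into two-sided concentration at `2E*`.
* `stub_centredLocalLimit` (M, provable now) — diagonal choice of good centres + local matching compactness
  (`exists_subseq_forall_eventually_ballMatch`): a non-empty uniformly discrete local limit around particles
  good at all scales, with eventual `θ`-goodness of every particle in every `R`-ball.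
* `stub_siteEnergyContinuity` (M, provable now) — site energies are continuous under separated local
  convergence (`r⁻⁶` tails), uniformly over the particles near a limit point.
* `TransitiveLocalLimit_of_parts` — the kernel-checked implication `stub₁-sig → … → stub₄-sig → crux statement`
  (sorry-free, REAL proof): separation from the PROVED `LennardJonesMinimalDistance_holds`; at `p ∈ X`, for
  every `γ > 0` some late `j` has a particle within `min ε 1` of `p` whose site energy is within `γ/2` of BOTH
  `U_X(p)` (stub 4) and `2E*` (stub 3 at radius `‖p‖ + 1`), so `|U_X(p) − 2E*| ≤ γ`; `eq_of_forall_dist_le`.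
* `TransitiveLocalLimit_of : PerronTransitivity.TransitiveLocalLimit` — the skeleton theorem: `_of_parts` applied
  to the four stubs; the ONLY theorem concluding the crux BY NAME (audit `#h21_check_skeleton`).

STATUS (lead c1, 2026-08-17T07:00Z): stubs 2, 3, 4 are LANDED (Theorems files
`PerronTransitivityTransitiveLocalLimitStubConcentration` p143639, `…StubCentredLocalLimit` p144572,
`…StubSiteEnergyContinuity` p145392; namespace `…Theorems.TransitiveLocalLimitBirth`) and are referenced below
instead of `sorry`; the ONLY remaining `sorry` is `stub_superBoundSparse` (the heart). Its K*-conditional form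
`superBoundSparse_of_noFractionalGain : NoFractionalGain → stub₁-sig` is LANDED (`…SuperBoundSparseOfK` p145414),
so `TransitiveLocalLimit` is reduced in-tree to the crux `NoFractionalGain` (stmt-15098) — support item 15101.

STATUS (lead c2, 2026-08-17T09:00Z): two further CONDITIONAL forms of stub 1 are registered on the item and
proved (`Theorems/PerronTransitivityTransitiveLocalLimitSuperBoundSparseOfBulkDefectVanish.lean`, p148212;
`…SuperBoundSparseOfKGroundStates.lean`, p148214): `superBoundSparse_of_bulkDefectVanish` — the shared positional
hinge `BulkDefectVanish` (stmt-0751, body inlined verbatim; compactness of `O(3)` + stub 4 + the pinned average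
give `U_P(0) = 2E*` and two-sided concentration) ⇒ stub₁-sig, whence `ThreeConeCertificate.BulkDefectVanish →
TransitiveLocalLimit`; and `superBoundSparse_of_copositive_groundStates` — K* tested on Lennard-Jones GROUND
STATES only (the weakest copositive hypothesis the line uses; robust to a `δ`-separated restatement of K*) ⇒
stub₁-sig ⇒ crux. The unconditional `stub_superBoundSparse` below remains the only `sorry`: it is the finite-`N`
heart of the crux (≈ the local half of 3-D Lennard-Jones crystallization) and closes in-tree by modus ponens
the moment EITHER stmt-15098 OR stmt-0751 lands.

Sorries live ONLY in the four `stub_*`; the signatures are fully inlined and fully qualified one-liners (a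
registered signature must survive textual restatement in a `Theorems/`-side `--supports` file).
Disproof.lean: none exists for this crux at registration (`ledger crux ls` 2026-08-17: no workfiles).
Negatives honoured: no `η`-soft local statement (EffectiveLocalHales 4146, OneGrainGluing 3506) occurs; every
stub is exact-in-the-limit / density-in-`N`.
-/

noncomputable section

namespace Summit.AtomisticToContinuum.Crystallization.Cruxes.TransitiveLocalLimit.Birth

open Filter

/-! ## Registered stubs (sorries live ONLY here; one-line fully qualified signatures) -/

/-- **STUB 1 — NO DENSITY OF SUPER-BOUND SITES** (the heart of the line; size L; the finite-`N`
content of `TransitiveLocalLimit` and exactly what the route's mechanism delivers): along every sequence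
of Lennard-Jones ground states `x N` and for every `θ > 0`, the sites bound BETTER than the crystal
average by `θ` — site energy `𝓔ⁱ(x N) = Σ_{k ≠ i} V_LJ(|x_i − x_k|) ≤ 2E* − θ`, `E* = ⨅_Q e_LJ(Q)` — have
density `#/N → 0`.  Route derivation (support item `FractionalGainGivesTransitivity`, stmt-15101): test the
copositive inequality `NoFractionalGain` (K*, stmt-15098) with weights `c = 1 + t·1_S`, `S` the super-bound
set, `t = θ / (2(|E*| + C_δ))`; direct attack: a positive density of `θ`-super-bound sites in a GROUND STATE
would be a bulk phase out-binding every periodic configuration (contradicting the proved floor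
`E(N)/N → E*` only after a localisation argument — this is where the difficulty sits).  Why it might fail:
exactly the crux's own risk (a non-vertex-transitive true minimiser, dhcp/4H-type, has two site classes
straddling `2E*`, and then super-bound sites have density `1/2`). -/
theorem stub_superBoundSparse : ∀ x : (N : ℕ) → (Fin N → EuclideanSpace ℝ (Fin 3)), (∀ N, Literature.MathematicalPhysics.StatisticalMechanics.IsGroundState Literature.MathematicalPhysics.StatisticalMechanics.lennardJones (x N)) → ∀ θ : ℝ, 0 < θ → Filter.Tendsto (fun N : ℕ => ((Finset.univ.filter fun i : Fin N => Literature.MathematicalPhysics.StatisticalMechanics.siteEnergy Literature.MathematicalPhysics.StatisticalMechanics.lennardJones (x N) i ≤ 2 * (⨅ Q : Literature.MathematicalPhysics.StatisticalMechanics.PeriodicConfiguration 3, Q.energyPerParticle Literature.MathematicalPhysics.StatisticalMechanics.lennardJones) - θ).card : ℝ) / N) Filter.atTop (nhds 0) := by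
  sorry

/-- **STUB 2 — PINNED AVERAGE KILLS SUB-BOUND SITES** (size M; provable now): for Lennard-Jones ground
states, if `θ`-super-bound sites have vanishing density for every `θ > 0` then so do all sites whose energy
is `θ`-FAR from `2E*` (two-sided concentration).  Proof sketch: `Σ_i 𝓔ⁱ(x N) = 2·E(N)`
(`two_mul_interactionEnergy`) and `E(N)/N → E*` (PROVED: `Theorems.ChargedEnergyGapNegative.crysEnergyLimit`),
so `Σ_i (𝓔ⁱ − 2E*) = o(N)`; site energies are uniformly bounded (`|𝓔ⁱ| ≤ C_δ` by the proved minimal distance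
`LennardJonesMinimalDistance_holds`, `abs_lennardJones_le_of_le`, `sum_inv_pow_six_le`); splitting the sum
into super-bound (`≥ −(C_δ + 2|E*|)·#super = −o(N)`), middle (`≥ −θ'N`) and `θ`-sub-bound (`≥ θ·#sub`) parts
gives `limsup #sub/N ≤ θ'/θ` for every `θ' > 0`. -/
theorem stub_concentration_of_superBoundSparse : ∀ x : (N : ℕ) → (Fin N → EuclideanSpace ℝ (Fin 3)), (∀ N, Literature.MathematicalPhysics.StatisticalMechanics.IsGroundState Literature.MathematicalPhysics.StatisticalMechanics.lennardJones (x N)) → (∀ θ : ℝ, 0 < θ → Filter.Tendsto (fun N : ℕ => ((Finset.univ.filter fun i : Fin N => Literature.MathematicalPhysics.StatisticalMechanics.siteEnergy Literature.MathematicalPhysics.StatisticalMechanics.lennardJones (x N) i ≤ 2 * (⨅ Q : Literature.MathematicalPhysics.StatisticalMechanics.PeriodicConfiguration 3, Q.energyPerParticle Literature.MathematicalPhysics.StatisticalMechanics.lennardJones) - θ).card : ℝ) / N) Filter.atTop (nhds 0)) → ∀ θ : ℝ, 0 < θ → Filter.Tendsto (fun N : ℕ => ((Finset.univ.filter fun i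 : Fin N => θ < |Literature.MathematicalPhysics.StatisticalMechanics.siteEnergy Literature.MathematicalPhysics.StatisticalMechanics.lennardJones (x N) i - 2 * (⨅ Q : Literature.MathematicalPhysics.StatisticalMechanics.PeriodicConfiguration 3, Q.energyPerParticle Literature.MathematicalPhysics.StatisticalMechanics.lennardJones)|).card : ℝ) / N) Filter.atTop (nhds 0) :=
  -- LANDED: Theorems/PerronTransitivityTransitiveLocalLimit… (this stub is closed)
  Summit.AtomisticToContinuum.Crystallization.Theorems.TransitiveLocalLimitBirth.stub_concentration_of_superBoundSparse

/-- **STUB 3 — CENTRED EXTRACTION** (size M; provable now; pure point-set compactness + counting, no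
energetics beyond the hypothesis): a uniformly separated sequence of finite configurations `x N`
(`N` particles) whose site energies concentrate IN DENSITY at a level `L` has, after a DIAGONAL CHOICE OF
CENTRES `τ N = −x N i_N` (a particle `i_N` whose whole `k`-ball is `1/k`-good for every `k ≤ K(N) → ∞`:
each bad particle spoils at most `(2k/δ + 1)³` centres, `card_le_of_separated_of_dist_le`, so spoiled
centres have density `→ 0` at every fixed level) and along a subsequence `σ`
(`exists_subseq_forall_eventually_ballMatch`, LocalMatchingCompactness.lean, applied to the translated point
sets), a NON-EMPTY (the centre sits at `0`, and a uniformly discrete limit matched at every tolerance contains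
`0`) uniformly discrete local limit `X` — two-way matching on every ball, the clause of
`IsLocalLimitOfGroundStates` verbatim — such that, at every radius `R` and tolerance `θ > 0`, EVENTUALLY
every particle of the translated configuration in the `R`-ball has site energy within `θ` of `L`. -/
theorem stub_centredLocalLimit : ∀ x : (N : ℕ) → (Fin N → EuclideanSpace ℝ (Fin 3)), (∃ δ : ℝ, 0 < δ ∧ ∀ (N : ℕ) (i j : Fin N), i ≠ j → δ ≤ dist (x N i) (x N j)) → ∀ L : ℝ, (∀ θ : ℝ, 0 < θ → Filter.Tendsto (fun N : ℕ => ((Finset.univ.filter fun i : Fin N => θ < |Literature.MathematicalPhysics.StatisticalMechanics.siteEnergy Literature.MathematicalPhysics.StatisticalMechanics.lennardJones (x N) i - L|).card : ℝ) / N) Filter.atTop (nhds 0)) → ∃ (X : Set (EuclideanSpace ℝ (Fin 3))) (σ : ℕ → ℕ) (τ : ℕ → EuclideanSpace ℝ (Fin 3)), X.Nonempty ∧ (∃ δ : ℝ, 0 < δ ∧ ∀ p ∈ X, ∀ q ∈ X, p ≠ q → δ ≤ dist p q) ∧ StrictMono σ ∧ (∀ R ε : ℝ, 0 < ε → ∀ᶠ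 j : ℕ in Filter.atTop, (∀ p ∈ X, ‖p‖ ≤ R → ∃ i : Fin (σ j), dist (x (σ j) i + τ j) p ≤ ε) ∧ (∀ i : Fin (σ j), ‖x (σ j) i + τ j‖ ≤ R → ∃ p ∈ X, dist (x (σ j) i + τ j) p ≤ ε)) ∧ (∀ R θ : ℝ, 0 < θ → ∀ᶠ j : ℕ in Filter.atTop, ∀ i : Fin (σ j), ‖x (σ j) i + τ j‖ ≤ R → |Literature.MathematicalPhysics.StatisticalMechanics.siteEnergy Literature.MathematicalPhysics.StatisticalMechanics.lennardJones (x (σ j)) i - L| ≤ θ) :=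
  -- LANDED: Theorems/PerronTransitivityTransitiveLocalLimit… (this stub is closed)
  Summit.AtomisticToContinuum.Crystallization.Theorems.TransitiveLocalLimitBirth.stub_centredLocalLimit

/-- **STUB 4 — CONTINUITY OF SITE ENERGIES UNDER SEPARATED LOCAL CONVERGENCE** (size M; provable now):
if uniformly `δ`-separated finite configurations `z j` converge locally (two-way matching on every ball about
`0`) to a uniformly discrete `X ⊆ ℝ³`, then for every `p ∈ X` and `γ > 0` there is `ε > 0` such that,
eventually in `j`, EVERY particle within `ε` of `p` has site energy within `γ` of the site energy of `X` at
`p`, `Σ'_{q ∈ X, q ≠ p} V_LJ(|p − q|)` (absolutely summable: `UniformlyDiscrete.summable_lennardJones_dist`).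
Proof sketch: `r⁻⁶` tails beyond a radius `ρ` are `≤ C_δ ρ⁻³` uniformly for `δ`-separated sets (shell sums,
`sum_inv_pow_six_le_of_forall_le_dist`); choose `ρ' ∈ (ρ, ρ + 1)` avoiding the finitely many distances
`|q − p|`, `q ∈ X ∩ B(p, ρ + 1)`; for `2ε < δ` the matching is then a bijection between the particles within
`ρ'` of the particle near `p` and `X ∩ B(p, ρ') ∖ {p}`, moving each distance by `≤ 2ε`, and `V_LJ` is
uniformly continuous on `[δ/2, ∞)`. -/
theorem stub_siteEnergyContinuity : ∀ (n : ℕ → ℕ) (z : (j : ℕ) → (Fin (n j) → EuclideanSpace ℝ (Fin 3))) (X : Set (EuclideanSpace ℝ (Fin 3))) (δ : ℝ), 0 < δ → (∀ (j : ℕ) (i i' : Fin (n j)), i ≠ i' → δ ≤ dist (z j i) (z j i')) → (∃ δ : ℝ, 0 < δ ∧ ∀ p ∈ X, ∀ q ∈ X, p ≠ q → δ ≤ dist p q) → (∀ R ε : ℝ, 0 < ε → ∀ᶠ j : ℕ in Filter.atTop, (∀ p ∈ X, ‖p‖ ≤ R → ∃ i : Fin (n j), dist (z j i) p ≤ ε)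 ∧ (∀ i : Fin (n j), ‖z j i‖ ≤ R → ∃ p ∈ X, dist (z j i) p ≤ ε)) → ∀ p ∈ X, ∀ γ : ℝ, 0 < γ → ∃ ε : ℝ, 0 < ε ∧ ∀ᶠ j : ℕ in Filter.atTop, ∀ i : Fin (n j), dist (z j i) p ≤ ε → |Literature.MathematicalPhysics.StatisticalMechanics.siteEnergy Literature.MathematicalPhysics.StatisticalMechanics.lennardJones (z j) i - ∑' q : {q : EuclideanSpace ℝ (Fin 3) // q ∈ X ∧ q ≠ p}, Literature.MathematicalPhysics.StatisticalMechanics.lennardJones (dist p q.1)| ≤ γ :=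
  -- LANDED: Theorems/PerronTransitivityTransitiveLocalLimit… (this stub is closed)
  Summit.AtomisticToContinuum.Crystallization.Theorems.TransitiveLocalLimitBirth.stub_siteEnergyContinuity

/-! ## Glue lemma (proved) -/

/-- Translating a finite configuration does not change its site energies. -/
theorem siteEnergy_add_const {N : ℕ} (V : ℝ → ℝ) (y : Fin N → EuclideanSpace ℝ (Fin 3)) (c : EuclideanSpace ℝ (Fin 3)) (i : Fin N) :
    Literature.MathematicalPhysics.StatisticalMechanics.siteEnergy V (fun k => y k + c) i = Literature.MathematicalPhysics.StatisticalMechanics.siteEnergy V y i := by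
  unfold Literature.MathematicalPhysics.StatisticalMechanics.siteEnergy
  refine Finset.sum_congr rfl fun k _ => ?_
  rw [dist_add_right]

/-! ## The kernel-checked composition (no `sorry` of its own) -/

/-- THE REAL PROOF (sorry-free, axioms `propext`/`Classical.choice`/`Quot.sound`):
`stub_superBoundSparse-sig → stub_concentration_of_superBoundSparse-sig → stub_centredLocalLimit-sig →
stub_siteEnergyContinuity-sig → <the crux statement>`; the conclusion is the text of the route decl
`PerronTransitivity.TransitiveLocalLimit` VERBATIM (definitionally equal; it is spelled out, not named, so that
exactly ONE theorem of this file — `TransitiveLocalLimit_of` below — concludes the crux BY NAME, as the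
`#h21_check_skeleton` audit requires). -/
theorem TransitiveLocalLimit_of_parts : (∀ x : (N : ℕ) → (Fin N → EuclideanSpace ℝ (Fin 3)), (∀ N, Literature.MathematicalPhysics.StatisticalMechanics.IsGroundState Literature.MathematicalPhysics.StatisticalMechanics.lennardJones (x N)) → ∀ θ : ℝ, 0 < θ → Filter.Tendsto (fun N : ℕ => ((Finset.univ.filter fun i : Fin N => Literature.MathematicalPhysics.StatisticalMechanics.siteEnergy Literature.MathematicalPhysics.StatisticalMechanics.lennardJones (x N) i ≤ 2 * (⨅ Q : Literature.MathematicalPhysics.StatisticalMechanics.PeriodicConfiguration 3, Q.energyPerParticle Literature.MathematicalPhysics.StatisticalMechanics.lennardJones) - θ).card : ℝ) / N) Filter.atTop (nhds 0)) → (∀ x : (N : ℕ) → (Fin N → EuclideanSpace ℝ (Fin 3)), (∀ N, Literature.MathematicalPhysics.StatisticalMechanics.IsGroundState Literature.MathematicalPhysics.StatisticalMechanics.lennardJones (x N)) → (∀ θ : ℝ, 0 < θ → Filter.Tendsto (fun N : ℕ => ((Finset.univ.filter fun i : Fin N => Literature.MathematicalPhysics.StatisticalMechanics.siteEnergy Literature.MathematicalPhysics.StatisticalMechanics.lennardJones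 (x N) i ≤ 2 * (⨅ Q : Literature.MathematicalPhysics.StatisticalMechanics.PeriodicConfiguration 3, Q.energyPerParticle Literature.MathematicalPhysics.StatisticalMechanics.lennardJones) - θ).card : ℝ) / N) Filter.atTop (nhds 0)) → ∀ θ : ℝ, 0 < θ → Filter.Tendsto (fun N : ℕ => ((Finset.univ.filter fun i : Fin N => θ < |Literature.MathematicalPhysics.StatisticalMechanics.siteEnergy Literature.MathematicalPhysics.StatisticalMechanics.lennardJones (x N) i - 2 * (⨅ Q : Literature.MathematicalPhysics.StatisticalMechanics.PeriodicConfiguration 3, Q.energyPerParticle Literature.MathematicalPhysics.StatisticalMechanics.lennardJones)|).card : ℝ) / N) Filter.atTop (nhds 0)) → (∀ x : (N : ℕ) → (Fin N → EuclideanSpace ℝ (Fin 3)), (∃ δ : ℝ, 0 < δ ∧ ∀ (N : ℕ) (i j : Fin N), i ≠ j → δ ≤ dist (x N i) (x N j)) → ∀ L : ℝ, (∀ θ : ℝ, 0 < θ → Filter.Tendsto (fun N : ℕ => ((Finset.univ.filter fun i : Fin N => θ < |Literature.MathematicalPhysics.StatisticalMechanics.siteEnergy Literature.MathematicalPhysics.StatisticalMechanics.lennardJones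 (x N) i - L|).card : ℝ) / N) Filter.atTop (nhds 0)) → ∃ (X : Set (EuclideanSpace ℝ (Fin 3))) (σ : ℕ → ℕ) (τ : ℕ → EuclideanSpace ℝ (Fin 3)), X.Nonempty ∧ (∃ δ : ℝ, 0 < δ ∧ ∀ p ∈ X, ∀ q ∈ X, p ≠ q → δ ≤ dist p q) ∧ StrictMono σ ∧ (∀ R ε : ℝ, 0 < ε → ∀ᶠ j : ℕ in Filter.atTop, (∀ p ∈ X, ‖p‖ ≤ R → ∃ i : Fin (σ j), dist (x (σ j) i + τ j) p ≤ ε) ∧ (∀ i : Fin (σ j), ‖x (σ j) i + τ j‖ ≤ R → ∃ p ∈ X, dist (x (σ j) i + τ j) p ≤ ε)) ∧ (∀ R θ : ℝ, 0 < θ → ∀ᶠ j : ℕ in Filter.atTop, ∀ i : Fin (σ j), ‖x (σ j) i + τ j‖ ≤ R → |Literature.MathematicalPhysics.StatisticalMechanics.siteEnergy Literature.MathematicalPhysics.StatisticalMechanics.lennardJones (x (σ j)) i - L| ≤ θ)) → (∀ (n : ℕ → ℕ) (z : (j : ℕ) → (Fin (n j) → EuclideanSpace ℝ (Fin 3)))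 (X : Set (EuclideanSpace ℝ (Fin 3))) (δ : ℝ), 0 < δ → (∀ (j : ℕ) (i i' : Fin (n j)), i ≠ i' → δ ≤ dist (z j i) (z j i')) → (∃ δ : ℝ, 0 < δ ∧ ∀ p ∈ X, ∀ q ∈ X, p ≠ q → δ ≤ dist p q) → (∀ R ε : ℝ, 0 < ε → ∀ᶠ j : ℕ in Filter.atTop, (∀ p ∈ X, ‖p‖ ≤ R → ∃ i : Fin (n j), dist (z j i) p ≤ ε) ∧ (∀ i : Fin (n j), ‖z j i‖ ≤ R → ∃ p ∈ X, dist (z j i) p ≤ ε)) → ∀ p ∈ X, ∀ γ : ℝ, 0 < γ → ∃ ε : ℝ, 0 < ε ∧ ∀ᶠ j : ℕ in Filter.atTop, ∀ i : Fin (n j), dist (z j i) p ≤ ε → |Literature.MathematicalPhysics.StatisticalMechanics.siteEnergy Literature.MathematicalPhysics.StatisticalMechanics.lennardJones (z j) i - ∑' q : {q : EuclideanSpace ℝ (Fin 3) // q ∈ X ∧ q ≠ p}, Literature.MathematicalPhysics.StatisticalMechanics.lennardJones (dist p q.1)| ≤ γ) → (∀ x : (N : ℕ) → (Fin N → EuclideanSpace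 ℝ (Fin 3)), (∀ N, Literature.MathematicalPhysics.StatisticalMechanics.IsGroundState Literature.MathematicalPhysics.StatisticalMechanics.lennardJones (x N)) → ∃ (X : Set (EuclideanSpace ℝ (Fin 3))) (σ : ℕ → ℕ) (τ : ℕ → EuclideanSpace ℝ (Fin 3)), X.Nonempty ∧ (∃ δ : ℝ, 0 < δ ∧ ∀ p ∈ X, ∀ q ∈ X, p ≠ q → δ ≤ dist p q) ∧ StrictMono σ ∧ (∀ R ε : ℝ, 0 < ε → ∀ᶠ j : ℕ in Filter.atTop, (∀ p ∈ X, ‖p‖ ≤ R → ∃ i : Fin (σ j), dist (x (σ j) i + τ j) p ≤ ε) ∧ (∀ i : Fin (σ j), ‖x (σ j) i + τ j‖ ≤ R → ∃ p ∈ X, dist (x (σ j) i + τ j) p ≤ ε)) ∧ ∀ p ∈ X, ∑' q : {q : EuclideanSpace ℝ (Fin 3) // q ∈ X ∧ q ≠ p}, Literature.MathematicalPhysics.StatisticalMechanics.lennardJones (dist p q.1) = 2 * ⨅ Q : Literature.MathematicalPhysics.StatisticalMechanics.PeriodicConfiguration 3, Q.energyPerParticle Literature.MathematicalPhysics.StatisticalMechanics.lennardJones)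 := by
  intro h1 h2 h3 h4 x hx
  -- (1)+(2): two-sided concentration of the finite-`N` site energies at the level `2E*`
  have hconc := h2 x hx (h1 x hx)
  -- uniform minimal distance of Lennard-Jones ground states (PROVED in tree)
  obtain ⟨δ, hδ, hδsep⟩ := Literature.MathematicalPhysics.StatisticalMechanics.LennardJonesMinimalDistance_holds
  have hxsep : ∃ δ : ℝ, 0 < δ ∧ ∀ (N : ℕ) (i j : Fin N), i ≠ j → δ ≤ dist (x N i) (x N j) :=
    ⟨δ, hδ, fun N i j hij => hδsep N (x N) (hx N) i j hij⟩
  -- (3): centred extraction of a non-empty uniformly discrete local limit around good particles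
  obtain ⟨X, σ, τ, hne, hXsep, hσ, hmatch, hgood⟩ := h3 x hxsep _ hconc
  refine ⟨X, σ, τ, hne, hXsep, hσ, hmatch, fun p hp => ?_⟩
  -- (4): continuity of site energies along the translated subsequence, at the limit point `p`
  have hzsep : ∀ (j : ℕ) (i i' : Fin (σ j)), i ≠ i' →
      δ ≤ dist (x (σ j) i + τ j) (x (σ j) i' + τ j) := by
    intro j i i' hii'
    rw [dist_add_right]
    exact hδsep (σ j) (x (σ j)) (hx (σ j)) i i' hii'
  have hcont := h4 σ (fun j i => x (σ j) i + τ j) X δ hδ hzsep hXsep hmatch p hp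
  -- the site energy of `X` at `p` is within every `γ > 0` of `2E*`
  refine eq_of_forall_dist_le fun γ hγ => ?_
  obtain ⟨ε, hε, hεj⟩ := hcont (γ / 2) (half_pos hγ)
  have e2 := hmatch ‖p‖ (min ε 1) (lt_min hε one_pos)
  have e3 := hgood (‖p‖ + 1) (γ / 2) (half_pos hγ)
  obtain ⟨j, hj1, ⟨hj2, -⟩, hj3⟩ := (hεj.and (e2.and e3)).exists
  obtain ⟨i, hi⟩ := hj2 p hp le_rfl
  have hiε : dist (x (σ j) i + τ j) p ≤ ε := hi.trans (min_le_left _ _)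
  have hi1 : dist (x (σ j) i + τ j) p ≤ 1 := hi.trans (min_le_right _ _)
  have hnorm : ‖x (σ j) i + τ j‖ ≤ ‖p‖ + 1 := by
    have h := norm_le_norm_add_norm_sub' (x (σ j) i + τ j) p
    rw [← dist_eq_norm] at h
    linarith
  -- particle `i` is late and close to `p`: its site energy is `γ/2`-close to both `U_X(p)` and `2E*`
  have hA : |Literature.MathematicalPhysics.StatisticalMechanics.siteEnergy Literature.MathematicalPhysics.StatisticalMechanics.lennardJones (x (σ j)) i -
      ∑' q : {q : EuclideanSpace ℝ (Fin 3) // q ∈ X ∧ q ≠ p}, Literature.MathematicalPhysics.StatisticalMechanics.lennardJones (dist p q.1)| ≤ γ / 2 := by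
    simpa only [siteEnergy_add_const] using hj1 i hiε
  have hB := hj3 i hnorm
  rw [abs_sub_comm] at hA
  rw [Real.dist_eq]
  exact (abs_sub_le _ _ _).trans ((add_le_add hA hB).trans_eq (add_halves γ))

/-- THE SKELETON THEOREM: the four registered stubs compose to the crux, concluded BY NAME (the route decl
`Summit.AtomisticToContinuum.Crystallization.Theses.PerronTransitivity.TransitiveLocalLimit`); its only
`sorry`s are the stubs'. When the four stubs land (`propose --supports stmt-AtomisticToContinuum-15100`, by
name + signature), this file minus the `sorry`s is the crux proof (`propose --workitem`). -/
theorem TransitiveLocalLimit_of : Summit.AtomisticToContinuum.Crystallization.Theses.PerronTransitivity.TransitiveLocalLimit :=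
  TransitiveLocalLimit_of_parts stub_superBoundSparse stub_concentration_of_superBoundSparse stub_centredLocalLimit stub_siteEnergyContinuity

end Summit.AtomisticToContinuum.Crystallization.Cruxes.TransitiveLocalLimit.Birth

end
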